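import Literature.AlgebraicGeometry.HodgeTheory.AlgebraicMonodromyMumfordTate
import Literature.AlgebraicGeometry.HodgeTheory.DirectImageBaseChangeContinuous
import Literature.AlgebraicGeometry.HodgeTheory.BettiUniverseIsoTransport
import HarnessLib

/-!
# The monodromy group under base change: rational transports of `𝒳 ×_S S' → S'` versus those of
# `𝒳 → S`, and base changes along maps that carry every loop

Family `hodge`, layer `Literature/AlgebraicGeometry/HodgeTheory`; theorems only, no named fact.
Written by the prover seat `hodge-nonav-prover-Ax` (g14) for route `CyclicUnitaryPowers` (crux K1
`VeryGeneralDeckCommutatorsInHg`, stmt-HodgeConjecture-19544), programme ZARISKI: the general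
monodromy bookkeeping that turns Zariski's theorem "every loop of `S(ℂ)` at `g c` is homotopic to the
image of a loop of `S'(ℂ)` at `c`" into the statement consumed by the curve theorem
`CyclicUnitaryPowersCurvesOfLargeMonodromyHodgeOffCountable` (hypothesis (HL)): the whole monodromy
group of `𝒳 → S` at `g c`, conjugated by the fibre identification `𝒳'_c ≅ 𝒳_{g c}`, consists of
monodromies of the base change `𝒳' = 𝒳 ×_S S' → S'` at `c`.

* `isRatTransport_familyPullback_iff` — for ANY morphism of bases `g : S' ⟶ S` (both families
  cohomologically locally trivial over all complex points): `T'` is the rational transport of the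
  base change along `γ'` iff `(e_{s'}⁻¹)^* ∘ T' ∘ (e_{t'})^*`… precisely
  `(pullEquiv e_{s'})⁻¹ ≫ T' ≫ pullEquiv e_{t'}`, is the rational transport of `𝒳 → S` along the image
  path `g ∘ γ'` (the local system of the base change is the inverse image,
  `FiberClass.baseChange_transportFun_of_isCohomologicallyLocallyTrivialOn`; pattern of
  `CyclicCoverScaling.isRatTransport_familySpz_iff`, which is the case `g = toBaseSpz`).
* `conj_mem_ratMonodromyGroup_familyPullback` — if every loop of `S(ℂ)` at `g c` is homotopic to
  the image of a loop of `S'(ℂ)` at `c` (surjectivity of `π₁(S'(ℂ), c) → π₁(S(ℂ), g c)`), then for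
  every `T ∈ Γ_{g c}` the conjugate `pullEquiv e_c ≫ T ≫ (pullEquiv e_c)⁻¹` lies in `Γ'_c`.
* `exists_finiteIndex_conj_mem_ratMonodromyGroup_familyPullback` — the same packaged in the shape
  of hypothesis (HL) of the curve theorem (`Γ₀ = Γ_{g c}` itself, of index one).

## References

* [VoisinHodgeII2003] C. Voisin, *Hodge Theory and Complex Algebraic Geometry II*, CUP 2003, §3.1.2
  (local systems and monodromy; functoriality under base change).
* [HatcherAT2002] A. Hatcher, *Algebraic Topology* (2002), §1.3 Prop. 1.34 (uniqueness of lifts).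
-/

noncomputable section

namespace Literature.AlgebraicGeometry.HodgeTheory

open CategoryTheory
open _root_.Topology
open Literature.AlgebraicGeometry.Motives
open Literature.AlgebraicTopology.SingularHomology

variable {𝒳 S S' : SchemeOver ℂ} (π : 𝒳 ⟶ S) (g : S' ⟶ S) (k : ℕ)

/-- **Transport commutes with base change** (complex coefficients): the local system of the base
change is the inverse image of `Rᵏ π_* ℂ`
(`FiberClass.baseChange_transportFun_of_isCohomologicallyLocallyTrivialOn`). [cite: VoisinHodgeII2003, §3.1.2] -/
theorem map_inv_transportFun_familyPullback
    (hU : IsCohomologicallyLocallyTrivialOn π Set.univ)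
    (hU' : IsCohomologicallyLocallyTrivialOn (familyPullback.snd π g) Set.univ)
    {s' t' : (Set.univ : Set (ComplexPoints S'))} (γ' : Path s' t')
    (γ : Path (⟨AlgPoints.map g s'.1, Set.mem_univ _⟩ : (Set.univ : Set (ComplexPoints S)))
      ⟨AlgPoints.map g t'.1, Set.mem_univ _⟩)
    (hγ : ∀ u, AlgPoints.map g (γ' u).1 = (γ u).1)
    (α' : complexBetti (fiberOver (familyPullback.snd π g) s'.1) k) :
    complexBetti.map (fiberOverFamilyPullbackIso π g t'.1).inv k (transportFun (familyPullback.snd π g) k hU' ⟦γ'⟧ α') =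
      transportFun π k hU ⟦γ⟧ (complexBetti.map (fiberOverFamilyPullbackIso π g s'.1).inv k α') := by
  have h := FiberClass.baseChange_transportFun_of_isCohomologicallyLocallyTrivialOn π g hU hU' k γ γ' hγ α'
    (α := complexBetti.map (fiberOverFamilyPullbackIso π g s'.1).inv k α') rfl
  exact ((FiberClass.mk_eq_mk_iff _ _).1 h).symm

/-- **Rational transports under base change**: for any morphism of bases `g : S' ⟶ S`, `T'` is the
rational transport of the base change `𝒳 ×_S S' → S'` along `γ'` iff its conjugate by the fibre
identifications is the rational transport of `𝒳 → S` along the image path `γ = g ∘ γ'`.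
[cite: VoisinHodgeII2003, §3.1.2] -/
theorem isRatTransport_familyPullback_iff
    (hU : IsCohomologicallyLocallyTrivialOn π Set.univ)
    (hU' : IsCohomologicallyLocallyTrivialOn (familyPullback.snd π g) Set.univ)
    {s' t' : (Set.univ : Set (ComplexPoints S'))} (γ' : Path s' t')
    (γ : Path (⟨AlgPoints.map g s'.1, Set.mem_univ _⟩ : (Set.univ : Set (ComplexPoints S)))
      ⟨AlgPoints.map g t'.1, Set.mem_univ _⟩)
    (hγ : ∀ u, AlgPoints.map g (γ' u).1 = (γ u).1)
    (T' : bettiCohomology (fiberOver (familyPullback.snd π g) s'.1) k ≃ₗ[ℚ]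
      bettiCohomology (fiberOver (familyPullback.snd π g) t'.1) k) :
    IsRatTransport (familyPullback.snd π g) k hU' ⟦γ'⟧ T' ↔
      IsRatTransport π k hU ⟦γ⟧
        ((BettiUniverse.pullEquiv (fiberOverFamilyPullbackIso π g s'.1) k).symm ≪≫ₗ T' ≪≫ₗ BettiUniverse.pullEquiv (fiberOverFamilyPullbackIso π g t'.1) k) := by
  have hQ : ∀ v' : bettiCohomology (fiberOver (familyPullback.snd π g) s'.1) k,
      BettiUniverse.pull (fiberOverFamilyPullbackIso π g s'.1).hom k (BettiUniverse.pull (fiberOverFamilyPullbackIso π g s'.1).inv k v') = v' := fun v' => by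
    rw [← LinearMap.comp_apply, ← BettiUniverse.pull_comp, Iso.hom_inv_id, BettiUniverse.pull_id]; rfl
  have hQ' : ∀ v : bettiCohomology (fiberOver π (AlgPoints.map g s'.1)) k,
      BettiUniverse.pull (fiberOverFamilyPullbackIso π g s'.1).inv k (BettiUniverse.pull (fiberOverFamilyPullbackIso π g s'.1).hom k v) = v := fun v => by
    rw [← LinearMap.comp_apply, ← BettiUniverse.pull_comp, Iso.inv_hom_id, BettiUniverse.pull_id]; rfl
  have hnat : ∀ {X Y : SchemeOver ℂ} (f : X ⟶ Y) (v : bettiCohomology Y k),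
      ofRatClass _ k (BettiUniverse.pull f k v) = complexBetti.map f k (ofRatClass _ k v) := fun f v =>
    ofRatClass_map k (AlgPoints.mapContinuous (L := ℂ) f) v
  have key : ∀ v' : bettiCohomology (fiberOver (familyPullback.snd π g) s'.1) k,
      ofRatClass _ k (((BettiUniverse.pullEquiv (fiberOverFamilyPullbackIso π g s'.1) k).symm ≪≫ₗ T' ≪≫ₗ
          BettiUniverse.pullEquiv (fiberOverFamilyPullbackIso π g t'.1) k) (BettiUniverse.pull (fiberOverFamilyPullbackIso π g s'.1).inv k v')) =
        complexBetti.map (fiberOverFamilyPullbackIso π g t'.1).inv k (ofRatClass _ k (T' v')) := fun v' => by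
    rw [LinearEquiv.trans_apply, LinearEquiv.trans_apply, BettiUniverse.pullEquiv_symm_apply,
      BettiUniverse.pullEquiv_apply, hQ, hnat]
  constructor
  · intro hT' v
    conv_lhs => rw [← hQ' v]
    rw [key, hT', map_inv_transportFun_familyPullback π g k hU hU' γ' γ hγ, hnat,
      (fiberOverFamilyPullbackIso π g s'.1).complexBetti_map_inv_map_hom]
  · intro hT v'
    have hinj : Function.Injective (complexBetti.map (fiberOverFamilyPullbackIso π g t'.1).inv k) :=
      complexBetti_map_fiberOverFamilyPullbackIso_inv_injective π g t'.1 k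
    apply hinj
    rw [map_inv_transportFun_familyPullback π g k hU hU' γ' γ hγ, ← key, hT, hnat]

/-- The self-map of `S'(ℂ)`-as-`univ` induced by `g` into `S(ℂ)`-as-`univ` (the bases of the
monodromy groups are points of `univ`). [cite: VoisinHodgeII2003, §3.1.2] -/
def baseMapUniv : C((Set.univ : Set (ComplexPoints S')), (Set.univ : Set (ComplexPoints S))) :=
  ⟨fun u => ⟨AlgPoints.map g u.1, Set.mem_univ _⟩, (AlgPoints.continuous_map g).comp continuous_subtype_val |>.subtype_mk _⟩

/-- Value of `baseMapUniv`. [cite: VoisinHodgeII2003, §3.1.2] -/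
@[simp] theorem baseMapUniv_apply_coe (u : (Set.univ : Set (ComplexPoints S'))) :
    ((baseMapUniv g u : (Set.univ : Set (ComplexPoints S))) : ComplexPoints S) = AlgPoints.map g u.1 := rfl

/-- **Monodromy along maps carrying every loop.**  If every loop of `S(ℂ)` at `g c` is homotopic (with
fixed base point) to the image under `g` of a loop of `S'(ℂ)` at `c` — `π₁(S'(ℂ), c) → π₁(S(ℂ), g c)`
is onto — then for every monodromy transformation `T ∈ Γ_{g c}` of `𝒳 → S` the conjugate
`pullEquiv e_c ≫ T ≫ (pullEquiv e_c)⁻¹` by the fibre identification `e_c : 𝒳'_c ≅ 𝒳_{g c}` is a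
monodromy transformation of the base change `𝒳 ×_S S' → S'` at `c`. [cite: VoisinHodgeII2003, §3.1.2] -/
theorem conj_mem_ratMonodromyGroup_familyPullback
    (hU : IsCohomologicallyLocallyTrivialOn π Set.univ)
    (hU' : IsCohomologicallyLocallyTrivialOn (familyPullback.snd π g) Set.univ)
    (c : ComplexPoints S')
    (hlift : ∀ γ : Path (baseMapUniv g ⟨c, Set.mem_univ _⟩) (baseMapUniv g ⟨c, Set.mem_univ _⟩),
      ∃ δ : Path (⟨c, Set.mem_univ _⟩ : (Set.univ : Set (ComplexPoints S'))) ⟨c, Set.mem_univ _⟩,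
        Path.Homotopic.Quotient.mk γ = Path.Homotopic.Quotient.mk (δ.map (baseMapUniv g).continuous))
    {T : bettiCohomology (fiberOver π (AlgPoints.map g c)) k ≃ₗ[ℚ] bettiCohomology (fiberOver π (AlgPoints.map g c)) k}
    (hT : T ∈ ratMonodromyGroup π k hU ⟨AlgPoints.map g c, Set.mem_univ _⟩) :
    (BettiUniverse.pullEquiv (fiberOverFamilyPullbackIso π g c) k).trans (T.trans (BettiUniverse.pullEquiv (fiberOverFamilyPullbackIso π g c) k).symm) ∈
      ratMonodromyGroup (familyPullback.snd π g) k hU' ⟨c, Set.mem_univ _⟩ := by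
  obtain ⟨γq, hTq⟩ := hT
  induction γq using Quotient.ind with | _ γ => ?_
  obtain ⟨δ, hδ⟩ := hlift γ
  refine ⟨⟦δ⟧, ?_⟩
  have hγδ : ∀ u, AlgPoints.map g (δ u).1 = ((δ.map (baseMapUniv g).continuous) u).1 := fun u => rfl
  rw [isRatTransport_familyPullback_iff π g k hU hU' δ (δ.map (baseMapUniv g).continuous) hγδ]
  have hid : (BettiUniverse.pullEquiv (fiberOverFamilyPullbackIso π g c) k).symm ≪≫ₗ
      ((BettiUniverse.pullEquiv (fiberOverFamilyPullbackIso π g c) k).trans (T.trans (BettiUniverse.pullEquiv (fiberOverFamilyPullbackIso π g c) k).symm)) ≪≫ₗ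
        BettiUniverse.pullEquiv (fiberOverFamilyPullbackIso π g c) k = T := by
    ext v
    simp only [LinearEquiv.trans_apply, LinearEquiv.apply_symm_apply]
  rw [hid]
  have hq : (⟦δ.map (baseMapUniv g).continuous⟧ : Path.Homotopic.Quotient _ _) = ⟦γ⟧ := by
    change Path.Homotopic.Quotient.mk _ = Path.Homotopic.Quotient.mk _
    exact hδ.symm
  have key : ∀ q : Path.Homotopic.Quotient (baseMapUniv g ⟨c, Set.mem_univ _⟩) (baseMapUniv g ⟨c, Set.mem_univ _⟩),
      q = ⟦γ⟧ → IsRatTransport π k hU q T := by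
    rintro q rfl; exact hTq
  exact key _ hq

/-- **Packaged as hypothesis (HL)** of `hodgeConjectureFor_powers_offCountable_of_curve`: under the
same surjectivity hypothesis there is a finite-index subgroup `Γ₀ ≤ Γ_{g c}` (namely `Γ₀ = Γ_{g c}`)
all of whose conjugates by the fibre identification are monodromies of the base change at `c`.
[cite: VoisinHodgeII2003, §3.1.2] -/
theorem exists_finiteIndex_conj_mem_ratMonodromyGroup_familyPullback
    (hU : IsCohomologicallyLocallyTrivialOn π Set.univ)
    (hU' : IsCohomologicallyLocallyTrivialOn (familyPullback.snd π g) Set.univ)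
    (c : ComplexPoints S')
    (hlift : ∀ γ : Path (baseMapUniv g ⟨c, Set.mem_univ _⟩) (baseMapUniv g ⟨c, Set.mem_univ _⟩),
      ∃ δ : Path (⟨c, Set.mem_univ _⟩ : (Set.univ : Set (ComplexPoints S'))) ⟨c, Set.mem_univ _⟩,
        Path.Homotopic.Quotient.mk γ = Path.Homotopic.Quotient.mk (δ.map (baseMapUniv g).continuous)) :
    ∃ Γ₀ : Subgroup (bettiCohomology (fiberOver π (AlgPoints.map g c)) k ≃ₗ[ℚ]
        bettiCohomology (fiberOver π (AlgPoints.map g c)) k),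
      Γ₀ ≤ ratMonodromyGroup π k hU ⟨AlgPoints.map g c, Set.mem_univ _⟩ ∧
      (Γ₀.subgroupOf (ratMonodromyGroup π k hU ⟨AlgPoints.map g c, Set.mem_univ _⟩)).FiniteIndex ∧
      ∀ T ∈ Γ₀, (BettiUniverse.pullEquiv (fiberOverFamilyPullbackIso π g c) k).trans
          (T.trans (BettiUniverse.pullEquiv (fiberOverFamilyPullbackIso π g c) k).symm) ∈
        ratMonodromyGroup (familyPullback.snd π g) k hU' ⟨c, Set.mem_univ _⟩ := by
  refine ⟨ratMonodromyGroup π k hU ⟨AlgPoints.map g c, Set.mem_univ _⟩, le_rfl, ?_, fun T hT =>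
    conj_mem_ratMonodromyGroup_familyPullback π g k hU hU' c hlift hT⟩
  rw [Subgroup.subgroupOf_self]
  infer_instance

end Literature.AlgebraicGeometry.HodgeTheory

end
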